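import Summits.BirchSwinnertonDyer.BirchSwinnertonDyer.Theorems.SylvesterTwoHeegnerIndexCoupledDescentPrimitivity
import Summits.BirchSwinnertonDyer.BirchSwinnertonDyer.Theses.SylvesterTwoHeegnerIndex
import HarnessLib

/-!
# The COUPLED Cassels–Tate telescope, XXV: the (T-L5) PROVENANCE leaf of RESIDUE c v3 — the bottom point
# `x₀` with `Y = 2^{M₀} x₀ + T`, `x₀ ∉ 2E_p(K) + tors`, and `2M₀ ≤ ord₂(#Ш_an(E_p)·#Ш_an(E_{3p²}))`

Crux `UpperOffV0HSYPlus` (stmt-BirchSwinnertonDyer-19804), rows' display RESIDUE c v3 (`…TailFourOfResidue` p714972,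
l.23–27): under the TAIL's binders (a model `B` of `E_p` with `CB • B = cubeSumCurve p`, HSY's generator `P ∈ B(ℚ)`
modulo torsion, a point `Y ∈ B(K)` with the height display `qB·qA·ĥ(ιP) = 2^0·ĥ(Y)`, `p ≡ 4 (9)`), produce
`M₀`, `x₀`, `T` with `T` torsion, `Y ↦ 2^{M₀} • x₀ + T` on `E_p ⊗ K` (the display's transport
`congrEquiv ∘ pointEquivBaseChange`) and `2·M₀ ≤ ord₂(qB·qA)`.  PROVED here, with the extra clause the per-level
(T-L5) conjunct «`2^{2κ−1} • δ x₀ ≠ 0`» consumes: **`x₀ ∉ 2E_p(K) + E_p(K)_tors`**.  The argument is the cell's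
`2`-adic bookkeeping (memo two §15.1 / §57.4, x1b GEN 48), entirely from tree theorems: on the Mordell model
`W' = (CB • B)_K` with `θ = [ω]` (`SylvesterTwoCMNormForm.exists_omegaRot`), `P' = ιP ∉ 2W' + tors`
(`not_exists_eq_two_smul_add_torsion` + `descends_of_generator`), the `K`-line `n•Y = a•P' + b•θP'`
(`exists_zsmul_eq_of_finrank_eq_two`, rank `2` from `PublishedFactsTwoPlus`' HSY conjunct) with `n` ODD
(`exists_odd_zsmul_eq`); split `a = 2^{M₀}a″`, `b = 2^{M₀}b″` with `a″, b″` not both even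
(`exists_two_pow_split`); Bezout `u n + v 2^{M₀} = 1` gives `x₀ := u•(a″P' + b″θP') + v•Y` with
`Y = 2^{M₀} x₀ + uT'`; `x₀ ∈ 2W' + tors` would force `2 ∣ a″, b″` (`two_dvd_of_memTwo`); and
`qB·qA = (a² − ab + b²)/n²` (`eq_two_zpow_mul_norm_div_sq_of_height_identity`, `i = 0`) has
`ord₂ = 2M₀ + ord₂(a″² − a″b″ + b″²) ≥ 2M₀`.
* `exists_two_pow_split` — `(a, b) ≠ 0 ⇒ a = 2^m a″, b = 2^m b″, ¬(2 ∣ a″ ∧ 2 ∣ b″)`.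
* ★ `provenance_sylvesterPair` — RESIDUE l.23–27 (∃ M₀ x₀ T, three clauses) ∧ `x₀ ∉ 2E_p(K) + tors`, under the
  RESIDUE's binders VERBATIM (`p ≡ 4 (9)` branch).
Theorem-only (no definition, no named fact); nothing asserted on 19804; no stub closed; X12.CMAtTwo NOT proved; BSD not
claimed for any curve.  Sources: Hu–Shu–Yin 2019 pp. 8, 12 (display (bsd)); Gross–Zagier 1986; memo two §15.1, §57.4.
-/

-- every Summits module is named `Summit.<Summit>.<Problem>…`: the duplicated component is by design
set_option linter.dupNamespace false
set_option autoImplicit false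

noncomputable section

open scoped Classical

open WeierstrassCurve WeierstrassCurve.Affine WeierstrassCurve.Affine.Point NumberField IsDedekindDomain
  Literature.NumberTheory.EllipticCurves Literature.NumberTheory.EllipticCurves.HuShuYin2019
  Literature.NumberTheory.QuadraticFields

namespace Summit.BirchSwinnertonDyer.BirchSwinnertonDyer.Theorems.SylvesterTwoCoupledTelescope

open Summit.BirchSwinnertonDyer.BirchSwinnertonDyer.Theorems.SylvesterTwoCMNormForm
open Summit.BirchSwinnertonDyer.BirchSwinnertonDyer.Theorems.SylvesterTwoCoupledDescentPrimitivity
open Summit.BirchSwinnertonDyer.BirchSwinnertonDyer.Theses.SylvesterTwoHeegnerIndex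

/-- **The `2`-adic split of a non-zero integer pair**: `a = 2^m a″`, `b = 2^m b″` with `a″, b″` not both even.
[folklore] -/
theorem exists_two_pow_split : ∀ (k : ℕ) (a b : ℤ), a.natAbs + b.natAbs ≤ k → ¬ (a = 0 ∧ b = 0) →
    ∃ (m : ℕ) (a'' b'' : ℤ), a = 2 ^ m * a'' ∧ b = 2 ^ m * b'' ∧ ¬ (2 ∣ a'' ∧ 2 ∣ b'') := by
  intro k
  induction k with
  | zero =>
    intro a b hk hab
    exact absurd ⟨Int.natAbs_eq_zero.mp (by omega), Int.natAbs_eq_zero.mp (by omega)⟩ hab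
  | succ k ih =>
    intro a b hk hab
    by_cases h2 : 2 ∣ a ∧ 2 ∣ b
    · obtain ⟨⟨a₁, rfl⟩, ⟨b₁, rfl⟩⟩ := h2
      have hab₁ : ¬ (a₁ = 0 ∧ b₁ = 0) := by rintro ⟨rfl, rfl⟩; exact hab ⟨by ring, by ring⟩
      have hpos : 0 < a₁.natAbs + b₁.natAbs := by
        rcases not_and_or.mp hab₁ with h | h
        · exact Nat.add_pos_left (Int.natAbs_pos.mpr h) _
        · exact Nat.add_pos_right _ (Int.natAbs_pos.mpr h)
      have ha : (2 * a₁).natAbs = 2 * a₁.natAbs := by rw [Int.natAbs_mul]; rfl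
      have hb : (2 * b₁).natAbs = 2 * b₁.natAbs := by rw [Int.natAbs_mul]; rfl
      rw [ha, hb] at hk
      obtain ⟨m, a'', b'', rfl, rfl, h⟩ := ih a₁ b₁ (by omega) hab₁
      exact ⟨m + 1, a'', b'', by ring, by ring, h⟩
    · exact ⟨0, a, b, by ring, by ring, h2⟩

/-- ★ **RESIDUE c v3, (T-L5) PROVENANCE (l.23–27), `p ≡ 4 (mod 9)` branch, with `x₀ ∉ 2E_p(K) + tors`.**
Binders = the RESIDUE's, verbatim and in order. [cite: HuShuYin2019, p. 8, p. 12 display (bsd)]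
[cite: GrossZagier1986, Thm. I.6.3] -/
theorem provenance_sylvesterPair : PublishedFactsTwoPlus →
    ∀ (p : ℕ), p.Prime → p % 9 = 4 → (¬ ∃ x : ZMod p, x ^ 3 = 3) →
      ∀ (A B : WeierstrassCurve ℚ) [A.IsElliptic] [A.IsGloballyMinimal] [B.IsElliptic]
        [B.IsGloballyMinimal], (∃ C : VariableChange ℚ, C • B = HuShuYin2019.cubeSumCurve (p : ℚ)) →
        (∃ C : VariableChange ℚ, C • A = HuShuYin2019.cubeSumCurve (3 * (p : ℚ) ^ 2)) →
        4 < Nat.card (AddCommGroup.primaryComponent B.sha 2) *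
            Nat.card (AddCommGroup.primaryComponent A.sha 2) →
        ∀ (qB qA : ℚ), shaAn B = (qB : ℂ) → shaAn A = (qA : ℂ) → qB * qA ≠ 0 →
        ∀ (K : Type) [Field K] [NumberField K] (ω : K), ω ^ 2 + ω + 1 = 0 →
          Module.finrank ℚ K = 2 →
        ∀ (CB : VariableChange ℚ) (hCB : CB • B = HuShuYin2019.cubeSumCurve (p : ℚ))
          (P : B.toAffine.Point) (Y : (B.baseChange K).toAffine.Point),
          ¬ IsOfFinAddOrder (WeierstrassCurve.QuadraticDescent.incl K B P) →
          (∀ Q : B.toAffine.Point, ∃ m : ℤ, IsOfFinAddOrder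
            (WeierstrassCurve.QuadraticDescent.incl K B Q -
              m • WeierstrassCurve.QuadraticDescent.incl K B P)) →
          ((qB * qA : ℚ) : ℝ) *
              WeierstrassCurve.Affine.Point.canonicalHeight (WeierstrassCurve.QuadraticDescent.incl K B P) =
            (2 : ℝ) ^ (if p % 9 = 4 then (0 : ℤ) else -2) *
              WeierstrassCurve.Affine.Point.canonicalHeight Y →
        ∃ (M₀ : ℕ) (x₀ T : ((cubeSumCurve (p : ℚ)).baseChange K).toAffine.Point),
        IsOfFinAddOrder T ∧
        Affine.Point.congrEquiv (congrArg (fun W : WeierstrassCurve ℚ ↦ W.baseChange K) hCB)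
            (VariableChange.pointEquivBaseChange B CB K Y) = ((2 ^ M₀ : ℕ) : ℤ) • x₀ + T ∧
        2 * (M₀ : ℤ) ≤ padicValRat 2 (qB * qA) ∧
        ¬ ∃ (Q T' : ((cubeSumCurve (p : ℚ)).baseChange K).toAffine.Point), IsOfFinAddOrder T' ∧ x₀ = 2 • Q + T' := by
  intro hF p hp h9 h3 A B _ _ _ _ hB hA _ qB qA hqB hqA hne K _ _ ω hω h2 CB hCB P Y hPinf hPgen hht
  have hp2 : p ≠ 2 := by rintro rfl; norm_num at h9
  -- ### rank `2` from the HSY conjunct of `PublishedFactsTwoPlus`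
  obtain ⟨-, -, -, -, -, hrank, -⟩ := hF.2 p hp (Or.inl h9) h3 A B hB hA K ω hω h2
  -- ### the Mordell model `W' = (CB • B)_K`, the transport `φ`, `[ω] = θ`, `P' = φ(ιP)`
  have ha1 : ((CB • B).baseChange K).a₁ = 0 := by rw [hCB]; simp [cubeSumCurve, WeierstrassCurve.baseChange]
  have ha2 : ((CB • B).baseChange K).a₂ = 0 := by rw [hCB]; simp [cubeSumCurve, WeierstrassCurve.baseChange]
  have ha3 : ((CB • B).baseChange K).a₃ = 0 := by rw [hCB]; simp [cubeSumCurve, WeierstrassCurve.baseChange]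
  have ha4 : ((CB • B).baseChange K).a₄ = 0 := by rw [hCB]; simp [cubeSumCurve, WeierstrassCurve.baseChange]
  haveI hBK : (B.baseChange K).IsElliptic := inferInstanceAs (B.map (algebraMap ℚ K)).IsElliptic
  haveI hCBK : ((CB • B).baseChange K).IsElliptic := inferInstanceAs ((CB • B).map (algebraMap ℚ K)).IsElliptic
  set φ := VariableChange.pointEquivBaseChange B CB K with hφdef
  have hφh : ∀ X, canonicalHeight (φ X) = canonicalHeight X := fun X ↦ canonicalHeight_pointEquivBaseChange B CB X
  obtain ⟨θ, hθ⟩ := exists_omegaRot (W := (CB • B).baseChange K) hω ha1 ha2 ha3 ha4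
  have hθ0 : (θ : _ → _) 0 = 0 := map_zero θ
  have hθ3 : ∀ X, θ.toAddMonoidHom (θ.toAddMonoidHom X) + θ.toAddMonoidHom X + X = 0 := fun X ↦
    omegaRot_omegaRot_add_omegaRot_add hω ha1 ha2 ha3 ha4 hθ0 hθ (omega_ne_one hω) X
  set P' := φ (WeierstrassCurve.QuadraticDescent.incl K B P) with hP'def
  have hP' : ¬IsOfFinAddOrder P' := fun h ↦ hPinf ((φ.injective.isOfFinAddOrder_iff (f := φ.toAddMonoidHom)).mp h)
  -- ### `P' ∉ 2W' + tors` (descent along the conjugation of `K/ℚ`)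
  obtain ⟨θ₀, c, hθ₀, hc⟩ := Quadratic.exists_sq_eq_algebraMap (F := ℚ) (K := K) h2
  have h2tor : ∀ X : ((CB • B).baseChange K).toAffine.Point, 2 • X = 0 → X = 0 :=
    Summit.BirchSwinnertonDyer.BirchSwinnertonDyer.Theorems.SylvesterTwoFrame.two_torsion_eq_zero_of_model_of_finrank_eq_two
      K h2 hp hp2 (CB • B) ⟨1, by rw [one_smul, hCB]⟩
  have hσσ : ∀ X, WeierstrassCurve.QuadraticDescent.conjMap (CB • B) (Quadratic.conj h2 hθ₀ hc)
      (WeierstrassCurve.QuadraticDescent.conjMap (CB • B) (Quadratic.conj h2 hθ₀ hc) X) = X :=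
    WeierstrassCurve.QuadraticDescent.conjMap_conjMap (CB • B) (Quadratic.conj_conj h2 hθ₀ hc)
  have hσP : WeierstrassCurve.QuadraticDescent.conjMap (CB • B) (Quadratic.conj h2 hθ₀ hc) P' = P' := by
    rw [hP'def, hφdef]
    show Affine.Point.map _ (VariableChange.pointEquivBaseChange B CB K _) = _
    rw [VariableChange.pointEquivBaseChange_map]
    exact congrArg (VariableChange.pointEquivBaseChange B CB K)
      (WeierstrassCurve.QuadraticDescent.conjMap_incl B (Quadratic.conj h2 hθ₀ hc) P)
  have hP2 : ¬ ∃ (Q T : ((CB • B).baseChange K).toAffine.Point), IsOfFinAddOrder T ∧ P' = 2 • Q + T :=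
    not_exists_eq_two_smul_add_torsion
      (WeierstrassCurve.QuadraticDescent.conjMap (CB • B) (Quadratic.conj h2 hθ₀ hc)) hσσ h2tor hP' hσP
      (fun X hX ↦ descends_of_generator h2 hθ₀ hc B CB hPgen X hX)
  -- ### the `K`-line with an ODD coefficient: `n • φY = a • P' + b • θP' + T'`
  have hr : Module.finrank ℤ ((CB • B).baseChange K).toAffine.Point = 2 := by
    rw [← φ.toIntLinearEquiv.finrank_eq]; exact hrank
  obtain ⟨n₀, a₀, b₀, hn₀, hY₀⟩ := exists_zsmul_eq_of_finrank_eq_two hω ha1 ha2 ha3 ha4 hθ0 hθ hr hP' (φ Y)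
  obtain ⟨n, a, b, T', hodd, hT', hYn⟩ := exists_odd_zsmul_eq θ.toAddMonoidHom hθ3 P' hP2
    n₀.natAbs le_rfl hn₀ IsOfFinAddOrder.zero hY₀
  have hn : n ≠ 0 := by rintro rfl; exact hodd ⟨0, rfl⟩
  -- the explicit quotient `qB·qA = 2^0 · (a² − ab + b²)/n²`
  have hid : ((qB * qA : ℚ) : ℝ) * canonicalHeight P' = (2 : ℝ) ^ (0 : ℤ) * canonicalHeight (φ Y) := by
    rw [hP'def, hφh, hφh, hht, if_pos h9]
  obtain ⟨hab, hqe⟩ := eq_two_zpow_mul_norm_div_sq_of_height_identity hω ha1 ha2 ha3 ha4 hθ0 hθ hP' hT' hn hYn hne hid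
  -- ### split `a = 2^{M₀} a″`, `b = 2^{M₀} b″`, and Bezout `u n + v 2^{M₀} = 1`
  obtain ⟨M₀, a'', b'', rfl, rfl, hab''⟩ := exists_two_pow_split _ a b le_rfl hab
  have hcop : IsCoprime n ((2 : ℤ) ^ M₀) := by
    obtain ⟨k, hk⟩ := Int.not_even_iff_odd.mp (fun h ↦ hodd (even_iff_two_dvd.mp h))
    exact (show IsCoprime n 2 from ⟨1, -k, by rw [hk]; ring⟩).pow_right
  obtain ⟨u, v, huv⟩ := hcop
  -- ### the bottom point
  obtain ⟨x₁, hx₁⟩ : ∃ x₁ : ((CB • B).baseChange K).toAffine.Point, x₁ = a'' • P' + b'' • θ P' := ⟨_, rfl⟩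
  have hYn' : n • φ Y = ((2 : ℤ) ^ M₀) • x₁ + T' := by
    rw [hYn, hx₁, smul_add, smul_smul, smul_smul]; rfl
  obtain ⟨x₀', hx₀'⟩ : ∃ x₀' : ((CB • B).baseChange K).toAffine.Point, x₀' = u • x₁ + v • φ Y := ⟨_, rfl⟩
  have hdec : φ Y = ((2 : ℤ) ^ M₀) • x₀' + u • T' := by
    rw [hx₀', smul_add, smul_comm ((2 : ℤ) ^ M₀) u x₁, smul_smul ((2 : ℤ) ^ M₀) v]
    calc φ Y = (u * n + v * 2 ^ M₀) • φ Y := by rw [huv, one_smul]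
      _ = u • (n • φ Y) + (v * 2 ^ M₀) • φ Y := by rw [add_smul, mul_smul]
      _ = u • (((2 : ℤ) ^ M₀) • x₁ + T') + (2 ^ M₀ * v) • φ Y := by rw [hYn', mul_comm v]
      _ = u • ((2 : ℤ) ^ M₀) • x₁ + (2 ^ M₀ * v) • φ Y + u • T' := by rw [smul_add]; abel
  -- `x₀' ∉ 2W' + tors`: `n • x₀' = x₁ + v • T'`
  have hnx₀ : n • x₀' = x₁ + v • T' := by
    rw [hx₀', smul_add, smul_comm n v (φ Y), hYn', smul_smul, smul_add, smul_smul, ← add_assoc, ← add_smul,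
      show n * u + v * 2 ^ M₀ = 1 by rw [mul_comm]; exact huv, one_smul]
  have hx₀'2 : ¬ ∃ (Q T'' : ((CB • B).baseChange K).toAffine.Point), IsOfFinAddOrder T'' ∧ x₀' = 2 • Q + T'' := by
    rintro ⟨Q, T'', hT'', hQ⟩
    apply hab''
    refine two_dvd_of_memTwo θ.toAddMonoidHom hθ3 P' hP2 ⟨n • Q, n • T'' - v • T', ?_, ?_⟩
    · rw [sub_eq_add_neg]; exact hT''.zsmul.add hT'.zsmul.neg
    · show a'' • P' + b'' • θ P' = 2 • (n • Q) + (n • T'' - v • T')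
      rw [← hx₁]
      have e : x₁ = n • x₀' - v • T' := by rw [hnx₀]; abel
      rw [e, hQ, smul_add, smul_comm n (2 : ℕ) Q]
      abel
  -- ### `2 M₀ ≤ ord₂ (qB·qA)`
  have hval : 2 * (M₀ : ℤ) ≤ padicValRat 2 (qB * qA) := by
    have hNne : (a'' ^ 2 - a'' * b'' + b'' ^ 2 : ℤ) ≠ 0 := fun h0 ↦ by
      obtain ⟨ha, hb⟩ := norm_eq_zero_iff.mp h0
      exact hab'' ⟨ha ▸ dvd_zero 2, hb ▸ dvd_zero 2⟩
    have hN : ((2 : ℤ) ^ M₀ * a'') ^ 2 - (2 ^ M₀ * a'') * (2 ^ M₀ * b'') + (2 ^ M₀ * b'') ^ 2 =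
        (2 : ℤ) ^ (2 * M₀) * (a'' ^ 2 - a'' * b'' + b'' ^ 2) := by ring
    have hNne' : (2 : ℤ) ^ (2 * M₀) * (a'' ^ 2 - a'' * b'' + b'' ^ 2) ≠ 0 :=
      mul_ne_zero (pow_ne_zero _ two_ne_zero) hNne
    have hnQ : (n : ℚ) ≠ 0 := by exact_mod_cast hn
    have hvn : padicValRat 2 (n : ℚ) = 0 := by
      rw [padicValRat.of_int, padicValInt.eq_zero_of_not_dvd hodd]; rfl
    have hv : padicValRat 2 (qB * qA) = padicValInt 2 ((2 : ℤ) ^ (2 * M₀) * (a'' ^ 2 - a'' * b'' + b'' ^ 2)) := by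
      rw [hqe, hN, zpow_zero, one_mul, padicValRat.div (by exact_mod_cast hNne') (pow_ne_zero 2 hnQ),
        padicValRat.pow, hvn, mul_zero, sub_zero, padicValRat.of_int]
    rcases (padicValInt_dvd_iff (p := 2) (2 * M₀) _).mp
      (dvd_mul_right ((2 : ℤ) ^ (2 * M₀)) (a'' ^ 2 - a'' * b'' + b'' ^ 2)) with h0 | hle
    · exact absurd h0 hNne'
    · rw [hv]; exact_mod_cast hle
  -- ### transport to `E_p ⊗ K` along `congrEquiv`
  set ψ := Affine.Point.congrEquiv (congrArg (fun W : WeierstrassCurve ℚ ↦ W.baseChange K) hCB) with hψ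
  refine ⟨M₀, ψ x₀', ψ (u • T'), ψ.toAddMonoidHom.isOfFinAddOrder hT'.zsmul, ?_, hval, ?_⟩
  · show ψ (φ Y) = _
    rw [hdec, map_add, map_zsmul]; push_cast; rfl
  · rintro ⟨Q, T'', hT'', hQ⟩
    refine hx₀'2 ⟨ψ.symm Q, ψ.symm T'', ψ.symm.toAddMonoidHom.isOfFinAddOrder hT'', ?_⟩
    apply ψ.injective
    rw [hQ, map_add, map_nsmul, ψ.apply_symm_apply, ψ.apply_symm_apply]

end Summit.BirchSwinnertonDyer.BirchSwinnertonDyer.Theorems.SylvesterTwoCoupledTelescope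

end
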